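import Summits.BirchSwinnertonDyer.BirchSwinnertonDyer.Theorems.ClassRecordThreeHalvesAtThreeNormContinuity
import Summits.BirchSwinnertonDyer.Rank1Residual.X2.CellCBDPValueLZZRoadInputOfFact
import Literature.NumberTheory.QuadraticFields.HeegnerCondition
import HarnessLib

/-!
# Route `ClassRecordThree` (cell `bsd-stepL`), leaf `BDPValueLeafAtThree` (item stmt-BirchSwinnertonDyer-19406) and the
# H2 half of `HalvesAtThree` (19107) / (VC₃) (19493): NORM CONTINUITY AT `𝟙` (VN₃) for EVERY curve with `3 ∥ N` FROM
# THE REFEREED LIU–ZHANG–ZHANG FACT — hence `Three.BDPValueAt₃ W` on all of X11b@3 modulo that one published fact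
# (cross-cell supply from cell `bsd-eis`, seat `bsd-eis-cgshw` g15: the kernel rescale of Liu–Zhang–Zhang 2018 written
# for the X2 crux `BSDpOnCellC` carries NO reducibility, NO image and NO rank hypothesis)

HONEST FRAMING (cells `bsd-stepL` / `bsd-eis`): theorems only; nothing booked; O2 / B10 stay as labelled; no node,
label or census count moves in either cell; BSD(E,3) is proved for no class. Every theorem is CONDITIONAL on its
displayed binder: `LiuZhangZhang2018.thm151_thm153_modularCurve_heegnerVector` — Liu–Zhang–Zhang, Duke Math. J. 167
(2018) Thm. 1.5.1 (with Remark 1.1.2) ∧ Thm. 1.5.3 for `X₀(N) → E`, the Heegner test vector and `χ = 𝟙` at a prime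
`p ∣ N`, `p² ∤ N` SPLIT in `K` (the paper's only hypothesis, Assumption 1.8.1) — REFEREED, typed by `bsd-littype-08`
(p509230) with cited readings audited clause by clause (pub/bsd-eis/LIT-DOSSIER §82, §86); or, in the `…_of_lzzRoadInputIoo`
forms, on the typed input `X2.LZZRoadInputIoo` which that fact implies (`X2.lzzRoadInputIoo_of_thm151_thm153`, p515022).

## The supply

`Summit.BirchSwinnertonDyer.Rank1Residual.X2.exists_continuousDisplay_of_lzzRoadInputIoo` (p512988 = p513549, the
399-line kernel rescale of pub/bsd-eis/cgshw-MEMO-18 §5: virtual periods `Ω_K := 1`, `Ω_p := λ^{1/4}`, open-disc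
continuity of the Amice transform at `ρ = 1/2`, uniform avatar convergence, the factor ledger `𝔠 = ±2³u/(w_K²√d_K c_M²)`)
proves, for ANY globally minimal `W` with MULTIPLICATIVE reduction at an odd `p`, `p ∣ N`, `p² ∤ N`, any imaginary
quadratic `K` with `d_K < −4` in which `p` splits, any degree-one `𝔭 ∋ p` singled out by `ι'` (= `InducesPrime ι' 𝔭`
VERBATIM), Heegner hypothesis for `N`, anticyclotomic `κ` with generator `γ`, newform `f` of `W`, parametrisation `Dt`
with `p ∤ c`, Heegner point `P` through `ι_K`, and any `e : K → ℚ_p` inducing `𝔭` (here `embAt K 3 𝔭`): there are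
`Ω_K ≠ 0`, `Ω_p ≠ 0` and `u ∈ ℂ_p` with `‖u‖ = 1` such that Castella's display `ι'⁻¹(L^{BDP}_𝔭(f, φ_k, Ω_K))·Ω_p^{4n_k}`
tends to `u·((1 − a_p p⁻¹)·log_{ω_E} P)²` along every interpolation sequence through `κ` with `r_k(γ) → 1`. Taking
norms kills `u`: this IS (VN₃) of `ClassRecordThreeHalvesAtThreeNormContinuity.lean` (`bdpValueAt₃_of_normContinuity`).
Dictionary: `d_K < −4` ⟸ `Odd d_K` ∧ Heegner for `N` ∧ `3 ∣ N` (`3 ∤ d_K`, Stickelberger `d_K ≡ 1 (4)`, `d_K < 0`);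
`p` split ⟸ Heegner at `3 ∣ N`; `3 ∣ N`, `9 ∤ N` ⟸ `Mult W 3`; `ClassX11b` / `Surj` / `P` non-torsion are not used.

* `normContinuity₃_of_lzzRoadInputIoo` — (VN₃) at every `W`, from the typed input;
* `bdpValueLeafAtThree_of_lzzRoadInputIoo`, **`bdpValueLeafAtThree_of_thm151_thm153`** — the route leaf
  `BDPValueLeafAtThree` (item 19406) BY NAME, modulo the input / the REFEREED fact;
* `halvesAtThree_of_thm151_thm153_of_imcDivStub` — the crux `HalvesAtThree` (19107) from the fact and the registered
  H3 stub shape (`classRecordThree_halvesAtThree_of_normContinuity_of_imcDivStub`).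

What this is NOT: not H3 (`Three.IMCDivAt₃`, open); not (VC₃) with its `R₀`-unit `u` verbatim (the supply's `u` is
a norm-one element of `ℂ₃`; frame-free `u ∈ R₀ˣ` would need `√|d_K| ∈ R₀`, not attempted — and not needed: (VN₃)
is what the route consumes); not a Literature filing; not a count move.

References: [LiuZhangZhang2018] Duke Math. J. 167 (2018) Thm. 1.5.1, Remark 1.1.2, Thm. 1.5.3, Assumption 1.8.1
(pp. 745–751) = arXiv:1511.08172 Thm. 1.6/1.8; [Castella2018] Thm. 3.1–3.2 (shapes); [Washington1997] §7.1;
pub/bsd-eis/cgshw-MEMO-18, -19; pub/bsd-eis/k5-c4-MEMO-5 (the glue); pub/bsd-stepL PROOF-BDP §20.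
-/

set_option linter.dupNamespace false

noncomputable section

open scoped Classical Topology

open Filter WeierstrassCurve NumberField IsDedekindDomain Field PowerSeries
  Literature.NumberTheory.EllipticCurves Literature.NumberTheory.EllipticCurves.ModularForms
  Literature.NumberTheory.EllipticCurves.Rank1Residual
  Literature.NumberTheory.GaloisRepresentations Literature.NumberTheory.GaloisCohomology
  Summit.BirchSwinnertonDyer.Rank1Residual Summit.BirchSwinnertonDyer.Rank1Residual.X11b
  Summit.BirchSwinnertonDyer.Rank1Residual.X11b.AcSelmer
  Summit.BirchSwinnertonDyer.Rank1Residual.X11b.CongruenceLimit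
  Summit.BirchSwinnertonDyer.Rank1Residual.X11b.Halves
  Summit.BirchSwinnertonDyer.Rank1Residual.X11b.Three
  Summit.BirchSwinnertonDyer.BirchSwinnertonDyer.Theses.ClassRecordThree

namespace Summit.BirchSwinnertonDyer.BirchSwinnertonDyer.Theorems

/-! ## §1 (VN₃) at every curve from the typed LZZ input -/

section Supply

variable (W : WeierstrassCurve ℚ) [W.IsElliptic] [W.IsGloballyMinimal]

/-- **(VN₃) — norm continuity of Castella's display at `𝟙` — at EVERY minimal `W` and every X11b@3 classical datum, from
the typed Liu–Zhang–Zhang input `X2.LZZRoadInputIoo`**: the bsd-eis rescale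
`X2.exists_continuousDisplay_of_lzzRoadInputIoo` gives the display's limit `u·((1 − a₃·3⁻¹)·log_{ω_E} P)²` with `‖u‖ = 1`
(no reducibility / image / rank hypothesis), and taking norms kills `u`. Dictionary in the module docstring.
CONDITIONAL on `X2.LZZRoadInputIoo` (typed input; implied by the REFEREED LZZ fact, p515022); nothing booked.
[cite: LiuZhangZhang2018, Thm. 1.5.1 and Thm. 1.5.3 (Duke 167 pp. 748–749) (source of the input; nothing asserted at the kernel level)] -/
theorem normContinuity₃_of_lzzRoadInputIoo (hL : X2.LZZRoadInputIoo) :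
    ∀ (N : ℕ) [NeZero N] (K : Type) [Field K] [NumberField K] (Dt : ModularParametrizationData W N)
      (H : HeegnerDatum N (NumberField.discr K)) (ι : K →+* ℂ) (P : (W.baseChange K).toAffine.Point),
      ClassX11b W 3 → Surj W 3 → W.conductorNorm ℤ = N → IsImaginaryQuadratic K →
      Odd (NumberField.discr K) → SatisfiesHeegnerHypothesis N K →
      (W.quadraticTwist (NumberField.discr K : ℚ)).entireLFunction 1 ≠ 0 →
      WeierstrassCurve.Affine.Point.map ι.toRatAlgHom P = heegnerPointComplex Dt H →
      ¬ (3 : ℤ) ∣ Dt.c → ¬ IsOfFinAddOrder P →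
      ∀ (κ : ZpExtension K 3), κ.IsAnticyclotomic →
        ∀ (γ : Field.absoluteGaloisGroup K) [Fact (κ.IsTopGenerator γ)]
          (𝔭 : HeightOneSpectrum (𝓞 K)) (h𝔭 : ((3 : ℕ) : 𝓞 K) ∈ 𝔭.asIdeal)
          (he : 𝔭.asIdeal.ramificationIdx (𝓞 ℚ) = 1) (hf : 𝔭.asIdeal.inertiaDeg (𝓞 ℚ) = 1),
          ∀ (f : CuspForm (CongruenceSubgroup.Gamma0 N) 2), IsNewformOf W f →
            ∀ (ι' : PadicAlgCl 3 ≃+* ℂ), InducesPrime ι' 𝔭 →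
              ∃ (ΩK : ℂ) (Ωp : ℂ_[3]), ΩK ≠ 0 ∧ Ωp ≠ 0 ∧
                ∀ (φ : ℕ → HeckeCharacter K) (n : ℕ → ℕ) (r : ℕ → FramedGaloisRep K (PadicAlgCl 3) 1),
                  (∀ k, 0 < n k) → (∀ k (v : HeightOneSpectrum (𝓞 K)), (φ k).IsUnramifiedAt v) →
                  (∀ k, (φ k).HasInfinityType (fun _ ↦ (n k : ℤ)) (fun _ ↦ -(n k : ℤ))) →
                  (∀ k, IsPAdicAvatarOf ι' (φ k) (r k)) → (∀ k, FactorsThroughZp κ (r k)) →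
                  Tendsto (fun k ↦ avatarValueAt (r k) γ) atTop (𝓝 1) →
                  Tendsto (fun k ↦ ‖((ι'.symm (bdpInterpolationValue 3 f 𝔭 (φ k) (n k) ΩK) :
                    PadicAlgCl 3) : ℂ_[3]) * Ωp ^ (4 * n k)‖) atTop
                    (𝓝 (‖algebraMap ℚ_[3] ℂ_[3] (((1 : ℚ_[3]) - ((W.LFunction 3 : ℤ) : ℚ_[3]) *
                        (3 : ℚ_[3])⁻¹) * logOmega W 3 (embAt K 3 𝔭 h𝔭 he hf) P)‖ ^ 2)) := by
  intro N _ K _ _ Dt H ι P hX _hsurj hN hK hodd hHN _hLt hP hcM _hPinf κ hκ γ hγ 𝔭 h𝔭 he hf f hfW ι' hι'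
  have hp : (3 : ℕ).Prime := Fact.out
  have hmult : W.HasMultiplicativeReductionAtPrime 3 := hX.2.2.1
  -- `3 ∣ N`, `9 ∤ N`, `3` split in `K`, `3 ∤ d_K`, hence `d_K < -4`
  have hpN : 3 ∣ N := hN ▸ X11b.dvd_conductorNorm_of_mult (W := W) hmult
  have hp2N : ¬ 3 ^ 2 ∣ N := hN ▸ X2.not_sq_dvd_conductorNorm_of_mult W 3 hmult
  have hsplit : ((Ideal.span {((3 : ℕ) : ℤ)}).primesOver (𝓞 K)).ncard = 2 := hHN 3 hp hpN
  have hdisc : ¬ ((3 : ℕ) : ℤ) ∣ NumberField.discr K :=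
    Literature.SatisfiesHeegnerHypothesis.not_dvd_discr hK.1 hHN hp hpN
  have hneg : NumberField.discr K < 0 := IsImaginaryQuadratic.discr_neg hK
  have hmod4 := Literature.NumberTheory.QuadraticFields.Quadratic.discr_emod_four (K := K) hK.1
  have hd4 : NumberField.discr K < -4 := by
    obtain ⟨m, hm⟩ := hodd
    have h3 : NumberField.discr K ≠ -3 := fun h ↦ hdisc ⟨-1, by rw [h]; norm_num⟩
    omega
  -- the logarithm is read along `embAt`
  have hemb : ∀ k : 𝓞 K, k ∈ 𝔭.asIdeal ↔ ‖embAt K 3 𝔭 h𝔭 he hf (k : K)‖ < 1 :=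
    mem_asIdeal_iff_norm_embAt_lt_one 𝔭 h𝔭 he hf
  obtain ⟨ΩK, Ωp, u, hΩK, hΩp, hu, hcont⟩ :=
    X2.exists_continuousDisplay_of_lzzRoadInputIoo hL ι' W K 𝔭 κ γ Dt H ι (embAt K 3 𝔭 h𝔭 he hf) P f
      (by decide) hmult hN hpN hp2N hK hd4 hsplit h𝔭 hι' hHN hκ hγ.out hfW hcM hP hemb
  refine ⟨ΩK, Ωp, hΩK, hΩp, fun φ n r hn hunr hinf hav hfac hlim ↦ ?_⟩
  have h := (hcont φ n r hn hunr hinf hav hfac hlim).norm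
  rwa [norm_mul, hu, one_mul, norm_pow, ← R1.logOmega_eq_padicLogOmega] at h

end Supply

/-! ## §2 Item level: the H2 leaf and the crux modulo its H3 stub, from the input / from the REFEREED fact -/

/-- **The route leaf `BDPValueLeafAtThree` (item 19406) BY NAME from the typed LZZ input** — §1 at every curve, then
`classRecordThree_bdpValueLeafAtThree_of_normContinuity`. CONDITIONAL on `X2.LZZRoadInputIoo`; nothing booked.
[cite: LiuZhangZhang2018, Thm. 1.5.1 and Thm. 1.5.3 (Duke 167 pp. 748–749) (source of the input; nothing asserted)] -/
theorem bdpValueLeafAtThree_of_lzzRoadInputIoo (hL : X2.LZZRoadInputIoo) : BDPValueLeafAtThree :=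
  classRecordThree_bdpValueLeafAtThree_of_normContinuity fun W _ _ ↦ normContinuity₃_of_lzzRoadInputIoo W hL

/-- **The route leaf `BDPValueLeafAtThree` (item 19406) BY NAME from the REFEREED Liu–Zhang–Zhang fact** (Duke 167
Thm. 1.5.1 ∧ 1.5.3 at `p ∣ N`, typed p509230) through the bsd-eis glue `X2.lzzRoadInputIoo_of_thm151_thm153` (p515022):
`Three.BDPValueAt₃ W` for every X11b@3 curve — the H2 half of O2@3 / B10 — rests on ONE published named fact and
kernel theorems. A `conditional-result` (hypothesis = a Literature named fact); nothing booked; no label or count moves.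
[cite: LiuZhangZhang2018, Thm. 1.5.1 and Remark 1.1.2 and Thm. 1.5.3 (Duke Math. J. 167 (2018) pp. 745–749)] -/
theorem bdpValueLeafAtThree_of_thm151_thm153
    (hF : LiuZhangZhang2018.thm151_thm153_modularCurve_heegnerVector) : BDPValueLeafAtThree :=
  bdpValueLeafAtThree_of_lzzRoadInputIoo (X2.lzzRoadInputIoo_of_thm151_thm153 hF)

/-- **The crux `HalvesAtThree` (item 19107) from the REFEREED LZZ fact and the registered H3 stub shape**
(`classRecordThree_halvesAtThree_of_normContinuity_of_imcDivStub` with (VN₃) supplied by §1): the H2 half is no longer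
an input. H3 (`Three.IMCDivAt₃`, the BDP-side anticyclotomic main-conjecture divisibility at `3 ∥ N`) stays OPEN and is
NOT discharged here. [cite: LiuZhangZhang2018, Thm. 1.5.1 and Thm. 1.5.3 (Duke 167 pp. 748–749)]
[cite: Castella2018, Thm. 3.3 (arXiv:1704.06608 p. 9) (shape of H3 only; open at p = 3)] -/
theorem halvesAtThree_of_thm151_thm153_of_imcDivStub
    (hF : LiuZhangZhang2018.thm151_thm153_modularCurve_heegnerVector)
    (h3 : ∀ (W : WeierstrassCurve ℚ) [W.IsElliptic] [W.IsGloballyMinimal], ClassX11b W 3 →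
      (Ram W 3 → W.HasSplitMultiplicativeReductionAtPrime 3 → IMCDivAt₃ W) ∧
        (¬ Ram W 3 → Surj W 3 → IMCDivAt₃ W)) :
    HalvesAtThree :=
  classRecordThree_halvesAtThree_of_normContinuity_of_imcDivStub
    (fun W _ _ ↦ normContinuity₃_of_lzzRoadInputIoo W (X2.lzzRoadInputIoo_of_thm151_thm153 hF)) h3

end Summit.BirchSwinnertonDyer.BirchSwinnertonDyer.Theorems

end
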